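/-
Copyright: public-audit package `pub-balaban` (b2b-balaban), seat pv09-g4. Released under Apache 2.0 like Mathlib.
-/
import Literature.MathematicalPhysics.QuantumFieldTheory.Balaban1983to89.B6LayerPoincare

/-!
# B6, p. 245: the layer Poincaré inequality on Δ′ with a constant of the sharp order 1/L (pair routing)

Source under audit: T. Bałaban, *Propagators and renormalization transformations for lattice gauge theories.
II*, Commun. Math. Phys. **96** (1984) 223–250 [B6], the sentence between (2.126) and (2.127), p. 245 (verbatim;
render `1984-cmp96-propagators-rt-II-p023-x2.png` READ AS IMAGE; the same quotation as in `B6LayerPoincare`):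
*"The terms in parentheses on the right-hand side can be written as L^{−2}⟨B, (Δ_{Δ′}^{L^{−1},N} +
Q′*_{Δ′}Q′_{Δ′})B⟩, where the operators are defined on a d − 1-dimensional lattice.  This quadratic form is
bounded from below by L^{−d−1} Σ_{x∈Δ′} |B_μ(x)|², hence"* [(2.127) follows].  Here the parenthesis of (2.126)
is ⅓ (L^{−d} Σ_{b⊂Δ′} |(∂B_μ)(b)|² + L^{−2} |Σ_{x∈Δ′} L^{−(d−1)} B_μ(x)|²).

(DOCFIX v1.1: v1 of this file, p181201, displayed at this place inside quotation marks a sentence — «… can be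
bounded from below by (1/2d) L^{−2} Σ … independently of …, e.g. using Fourier transformation» — that is NOT
printed anywhere in [B6]; withdrawn (x-read C-pv12g6-5 by pv12-g6).  With the printed factor 1 the sentence is
refuted for L = 10 as stated below; nothing else in the file referred to the withdrawn wording.)

## Status of the sentence and what this file proves

The sentence is FALSE as printed (`B6.claim_p245_fails_L10`); the true statement is a discrete Poincaré
inequality on the (d − 1)-dimensional layer Δ′ ≅ {0, …, L−1}^{d−1} whose constant decays like 1/L.
`B6LayerPoincare.layerPoincare` proved it with the crude explicit factor κ₀ = 1/(4 + 6d(L−1)L^{d−2}) (routing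
every point to the corner y*, whose bonds then carry L^{d−2}-fold load).  This file proves the SAME inequality, in
the SAME shape, with the factor

  κ₁(d, L) = 2 / (2 + (d − 1)(L − 1))   (`kappa1`),

which has the sharp order 1/L in L (the exact constant is κ_L = min{1, 4L sin²(π/2L)} ~ π²/L, `B6.kappaL`, not reached
here).  Method (folklore, "canonical paths" / pair routing): the Lagrange identity
N Σ_x g(x)² − (Σ_x g(x))² = ½ Σ_{x,x′} (g(x) − g(x′))² (N = #Δ′ = L^{d−1}); every ordered pair (x, x′) is joined by the
coordinate comb x = z₀, z₁, …, z_d = x′, z_k = (x′_{<k}, x_{≥k}) (`B6TreeGaugePoincare.comb x′ x k`), whose k-th leg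
is a straight segment inside Δ′ of at most L − 1 steps; Cauchy–Schwarz twice ((d − 1) legs, ≤ L − 1 steps) and the
EXACT load count — for fixed k the triples (x, x′, position on the k-th line) correspond bijectively to
(bond of direction k ⊂ Δ′, a point of Δ′, a value in {0, …, L−1}) (`load_eq`, an explicit `Finset.sum_nbij'`) — give
Σ_{x,x′} (g(x) − g(x′))² ≤ (d − 1)(L − 1) · N L · G(g), G(g) = Σ_{b⊂Δ′} (g(b₊) − g(b₋))² (`pair_sum_le`), hence
N Σ g² ≤ (Σ g)² + ½(d − 1)(L − 1) L^d G(g) and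

  `layerPoincare1_cleared`:  κ₁ L^{d−1} Σ_{x∈Δ′} g(x)² ≤ L^d G(g) + (Σ_{x∈Δ′} g(x))²,
  `layerPoincare1`:  κ₁ L^{−d−1} Σ_{x∈Δ′} g(x)² ≤ L^{−d} G(g) + L^{−2} (L^{−(d−1)} Σ_{x∈Δ′} g(x))²

(d ≥ 2, L ≥ 1, every corner y, direction μ, every g : Z^d → ℝ) — literally `B6LayerPoincare.layerPoincare(_cleared)`
with κ₀ replaced by κ₁.  The downstream chain ((2.127)_κ, Lemma 2.4_κ) is κ-monotone and is re-instantiated with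
κ₁ in a separate module.

HONEST SCOPE: DERIVED mathematics repairing a false printed sentence; nothing printed is used.  The cite tags on
the two final theorems name the sentence repaired.
-/

open Finset

namespace Literature.MathematicalPhysics.QuantumFieldTheory.Balaban1983to89.B6LayerPoincarePair

open B6Elimination (block mem_block)
open B6BondElimination (unitVec unitVec_apply add_unitVec_apply add_smul_unitVec_apply)
open B6TreeGaugePoincare (comb seg comb_zero seg_apply_self seg_apply_of_lt seg_apply_of_gt seg_top seg_bot
  seg_add_unitVec)
open B6FaceInterpolation (lastLayer bondsIn mem_lastLayer mem_bondsIn)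
open B6LayerPoincare (comb_self gradSq gradSq_nonneg card_lastLayer)

noncomputable section

variable {d : ℕ} {L : ℕ}

/-! ## §1  One dimension: telescoping and Cauchy–Schwarz along a line -/

/-- (G(a + n) − G(a))² ≤ n Σ_{s<n} (G(a + s + 1) − G(a + s))². [folklore] -/
theorem sq_le_steps (G : ℤ → ℝ) (a : ℤ) (n : ℕ) :
    (G (a + n) - G a) ^ 2 ≤ n * ∑ s ∈ range n, (G (a + s + 1) - G (a + s)) ^ 2 := by
  have tel : ∑ s ∈ range n, (G (a + s + 1) - G (a + s)) = G (a + n) - G a := by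
    have key := Finset.sum_range_sub (fun s : ℕ => G (a + s)) n
    simp only [Nat.cast_zero, add_zero, Nat.cast_succ] at key
    rw [← key]
    refine sum_congr rfl fun s _ => ?_
    rw [add_assoc]
  rw [← tel]
  refine le_trans sq_sum_le_card_mul_sum_sq ?_
  rw [card_range]

/-- A shifted sub-range of a sum of non-negative terms: for b ≤ u, u + n ≤ b + m,
Σ_{s<n} F(u + s) ≤ Σ_{s<m} F(b + s). [folklore] -/
theorem sum_shift_le (F : ℤ → ℝ) (hF : ∀ t, 0 ≤ F t) {b u : ℤ} {n m : ℕ} (h1 : b ≤ u)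
    (h2 : u + n ≤ b + m) : ∑ s ∈ range n, F (u + s) ≤ ∑ s ∈ range m, F (b + s) := by
  classical
  set c : ℕ := (u - b).toNat with hc
  have hc' : (c : ℤ) = u - b := Int.toNat_of_nonneg (by omega)
  have e1 : ∑ s ∈ range n, F (u + s) = ∑ s ∈ range n, F (b + ((s + c : ℕ) : ℤ)) := by
    refine sum_congr rfl fun s _ => ?_
    congr 1; push_cast; omega
  have hinj : Set.InjOn (fun s : ℕ => s + c) ↑(range n) := fun s _ s' _ h => by simpa using h
  rw [e1, ← sum_image (g := fun s => s + c) (f := fun s' : ℕ => F (b + (s' : ℤ))) hinj]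
  refine sum_le_sum_of_subset_of_nonneg (fun s' hs' => ?_) fun _ _ _ => hF _
  obtain ⟨s, hs, rfl⟩ := mem_image.1 hs'
  have := mem_range.1 hs
  exact mem_range.2 (by omega)

/-- Symmetric form on a window: for u, v ∈ [b, b + m], (G(u) − G(v))² ≤ m Σ_{s<m} (G(b + s + 1) − G(b + s))².
[folklore] -/
theorem sq_le_window (G : ℤ → ℝ) {b u v : ℤ} {m : ℕ} (hu : b ≤ u) (hu' : u ≤ b + m) (hv : b ≤ v)
    (hv' : v ≤ b + m) : (G u - G v) ^ 2 ≤ m * ∑ s ∈ range m, (G (b + s + 1) - G (b + s)) ^ 2 := by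
  have hS : 0 ≤ ∑ s ∈ range m, (G (b + s + 1) - G (b + s)) ^ 2 := sum_nonneg fun _ _ => sq_nonneg _
  wlog huv : v ≤ u generalizing u v
  · have h := this hv hv' hu hu' (not_le.mp huv).le
    calc (G u - G v) ^ 2 = (G v - G u) ^ 2 := by ring
      _ ≤ _ := h
  obtain ⟨n, hn⟩ : ∃ n : ℕ, u = v + n := ⟨(u - v).toNat, by omega⟩
  have hnm : n ≤ m := by omega
  have step1 := sq_le_steps G v n
  rw [← hn] at step1
  have step2 : ∑ s ∈ range n, (G (v + s + 1) - G (v + s)) ^ 2 ≤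
      ∑ s ∈ range m, (G (b + s + 1) - G (b + s)) ^ 2 :=
    sum_shift_le (fun t => (G (t + 1) - G t) ^ 2) (fun _ => sq_nonneg _) hv (by omega)
  calc (G u - G v) ^ 2 ≤ n * ∑ s ∈ range n, (G (v + s + 1) - G (v + s)) ^ 2 := step1
    _ ≤ m * ∑ s ∈ range m, (G (b + s + 1) - G (b + s)) ^ 2 :=
        mul_le_mul (by exact_mod_cast hnm) step2 (sum_nonneg fun _ _ => sq_nonneg _) (Nat.cast_nonneg _)

/-! ## §2  The legs of the coordinate comb between two points of Δ′ -/

/-- The k-th leg of the comb from x to x′: g(z_k) − g(z_{k+1}), z_k = (x′_{<k}, x_{≥k}) = `comb x′ x k`.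
[folklore] -/
def leg (g : (Fin d → ℤ) → ℝ) (x x' : Fin d → ℤ) (k : Fin d) : ℝ := g (comb x' x k) - g (comb x' x (k + 1))

/-- The legs telescope: Σ_k (g(z_k) − g(z_{k+1})) = g(x) − g(x′). [folklore] -/
theorem sum_legs (g : (Fin d → ℤ) → ℝ) (x x' : Fin d → ℤ) : ∑ k : Fin d, leg g x x' k = g x - g x' := by
  have h := Fin.sum_univ_eq_sum_range (fun n : ℕ => g (comb x' x n) - g (comb x' x (n + 1))) d
  simp only [leg]
  rw [h, Finset.sum_range_sub', comb_zero, comb_self]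

/-- The μ-th leg vanishes when x_μ = x′_μ. [folklore] -/
theorem leg_eq_zero (g : (Fin d → ℤ) → ℝ) {x x' : Fin d → ℤ} {μ : Fin d} (h : x μ = x' μ) :
    leg g x x' μ = 0 := by
  have e : comb x' x μ = comb x' x (μ + 1) := by
    funext i
    simp only [comb]
    by_cases h1 : (i : ℕ) < μ
    · rw [if_pos h1, if_pos (by omega)]
    · by_cases h2 : (i : ℕ) = μ
      · rw [if_neg h1, if_pos (by omega), show i = μ from Fin.ext h2, h]
      · rw [if_neg h1, if_neg (by omega)]
  rw [leg, e, sub_self]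

/-- Cauchy–Schwarz over the d − 1 non-trivial legs: (g(x) − g(x′))² ≤ (d − 1) Σ_{k≠μ} leg_k² when x_μ = x′_μ.
[folklore] -/
theorem diff_sq_le_legs (g : (Fin d → ℤ) → ℝ) {x x' : Fin d → ℤ} {μ : Fin d} (h : x μ = x' μ) :
    (g x - g x') ^ 2 ≤ ((d : ℝ) - 1) * ∑ k ∈ univ.erase μ, leg g x x' k ^ 2 := by
  have e : g x - g x' = ∑ k ∈ univ.erase μ, leg g x x' k := by
    rw [← sum_legs g x x', ← Finset.sum_erase_add _ _ (mem_univ μ), leg_eq_zero g h, add_zero]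
  rw [e]
  refine le_trans sq_sum_le_card_mul_sum_sq (le_of_eq ?_)
  rw [card_erase_of_mem (mem_univ μ), card_univ, Fintype.card_fin, Nat.cast_sub (Fin.pos μ), Nat.cast_one]

/-- The bond term of direction k at the point p: (g(p + e_k) − g(p))². [folklore] -/
def bondTerm (g : (Fin d → ℤ) → ℝ) (k : Fin d) (p : Fin d → ℤ) : ℝ := (g (p + unitVec k) - g p) ^ 2

/-- The bond term is ≥ 0. [folklore] -/
theorem bondTerm_nonneg (g : (Fin d → ℤ) → ℝ) (k : Fin d) (p : Fin d → ℤ) : 0 ≤ bondTerm g k p := sq_nonneg _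

/-- One leg by the window estimate: leg_k² ≤ (L − 1) Σ_{s<L−1} (g(x″_s + e_k) − g(x″_s))², x″_s = (x′_{<k}, y_k + s, x_{>k})
(both end values x_k, x′_k lie in the window [y_k, y_k + L − 1]). [folklore] -/
theorem leg_sq_le {y x x' : Fin d → ℤ} {μ : Fin d} (hx : x ∈ lastLayer L y μ) (hx' : x' ∈ lastLayer L y μ)
    (g : (Fin d → ℤ) → ℝ) (k : Fin d) :
    leg g x x' k ^ 2 ≤ ((L - 1 : ℕ) : ℝ) * ∑ s ∈ range (L - 1), bondTerm g k (seg x' x k (y k + s)) := by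
  have hxk := mem_block.1 (mem_lastLayer.1 hx).1 k
  have hxk' := mem_block.1 (mem_lastLayer.1 hx').1 k
  have e : leg g x x' k = g (seg x' x k (x k)) - g (seg x' x k (x' k)) := by
    rw [leg, seg_top, seg_bot]
  rw [e]
  have h := sq_le_window (fun t => g (seg x' x k t)) (b := y k) (m := L - 1) (u := x k) (v := x' k)
    hxk.1 (by omega) hxk'.1 (by omega)
  refine le_trans h (le_of_eq ?_)
  congr 1
  refine sum_congr rfl fun s _ => ?_
  rw [bondTerm, seg_add_unitVec]

/-! ## §3  Points of Δ′ built with `seg`, and the exact load count -/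

/-- (u_{<k}, t, v_{>k}) ∈ Δ′ for u, v ∈ Δ′, k ≠ μ and y_k ≤ t < y_k + L. [folklore] -/
theorem seg_mem {y u v : Fin d → ℤ} {μ k : Fin d} (hk : k ≠ μ) (hu : u ∈ lastLayer L y μ)
    (hv : v ∈ lastLayer L y μ) {t : ℤ} (ht1 : y k ≤ t) (ht2 : t < y k + L) : seg u v k t ∈ lastLayer L y μ := by
  obtain ⟨hub, huμ⟩ := mem_lastLayer.1 hu
  obtain ⟨hvb, hvμ⟩ := mem_lastLayer.1 hv
  have hub' := mem_block.1 hub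
  have hvb' := mem_block.1 hvb
  refine mem_lastLayer.2 ⟨mem_block.2 fun i => ?_, ?_⟩
  · rcases lt_trichotomy i k with hik | hik | hki
    · rw [seg_apply_of_lt _ _ hik]; exact hub' i
    · rw [hik, seg_apply_self]; exact ⟨ht1, ht2⟩
    · rw [seg_apply_of_gt _ _ hki]; exact hvb' i
  · rcases lt_trichotomy μ k with hμk | hμk | hkμ
    · rw [seg_apply_of_lt _ _ hμk]; exact huμ
    · exact absurd hμk.symm hk
    · rw [seg_apply_of_gt _ _ hkμ]; exact hvμ

/-- The starts of the bonds of direction k inside S: P_k = {p ∈ S : p + e_k ∈ S}. [folklore] -/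
def starts (S : Finset (Fin d → ℤ)) (k : Fin d) : Finset (Fin d → ℤ) := S.filter fun p => p + unitVec k ∈ S

/-- Membership in P_k. [folklore] -/
theorem mem_starts {S : Finset (Fin d → ℤ)} {k : Fin d} {p : Fin d → ℤ} :
    p ∈ starts S k ↔ p ∈ S ∧ p + unitVec k ∈ S := mem_filter

/-- G(g) = Σ_k Σ_{p∈P_k} (g(p + e_k) − g(p))² (the bonds ⊂ S sorted by direction). [folklore] -/
theorem gradSq_eq (g : (Fin d → ℤ) → ℝ) (S : Finset (Fin d → ℤ)) :
    gradSq g S = ∑ k : Fin d, ∑ p ∈ starts S k, bondTerm g k p := by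
  simp only [gradSq, bondsIn, sum_filter, sum_product, starts, bondTerm]
  exact sum_comm

/-- The forward reindexing map: (x, x′, s) ↦ (p, w, u) = ((x′_{<k}, y_k + s, x_{>k}), (x_{<k}, x_k, x′_{>k}), x′_k − y_k).
[folklore] -/
def fwd (y : Fin d → ℤ) (k : Fin d) (a : ((Fin d → ℤ) × (Fin d → ℤ)) × ℕ) : ((Fin d → ℤ) × (Fin d → ℤ)) × ℕ :=
  ((seg a.1.2 a.1.1 k (y k + a.2), seg a.1.1 a.1.2 k (a.1.1 k)), (a.1.2 k - y k).toNat)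

/-- The backward reindexing map: (p, w, u) ↦ (x, x′, s) = ((w_{<k}, w_k, p_{>k}), (p_{<k}, y_k + u, w_{>k}), p_k − y_k).
[folklore] -/
def bwd (y : Fin d → ℤ) (k : Fin d) (a : ((Fin d → ℤ) × (Fin d → ℤ)) × ℕ) : ((Fin d → ℤ) × (Fin d → ℤ)) × ℕ :=
  ((seg a.1.2 a.1.1 k (a.1.2 k), seg a.1.1 a.1.2 k (y k + a.2)), (a.1.1 k - y k).toNat)

/-- Coordinate bookkeeping: ((u_{<k}, u_k, v_{>k})_{<k}, (u…)_k, (w_{<k}, t, u_{>k})_{>k}) = u. [folklore] -/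
theorem seg_seg_eq (u v w : Fin d → ℤ) (k : Fin d) (t : ℤ) :
    seg (seg u v k (u k)) (seg w u k t) k ((seg u v k (u k)) k) = u := by
  funext i
  rcases lt_trichotomy i k with hik | hik | hki
  · rw [seg_apply_of_lt _ _ hik, seg_apply_of_lt _ _ hik]
  · rw [hik, seg_apply_self, seg_apply_self]
  · rw [seg_apply_of_gt _ _ hki, seg_apply_of_gt _ _ hki]

/-- Coordinate bookkeeping: ((w_{<k}, t′, u_{>k})_{<k}, t, (u_{<k}, s, v_{>k})_{>k}) = (w_{<k}, t, v_{>k}). [folklore] -/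
theorem seg_seg_eq' (u v w : Fin d → ℤ) (k : Fin d) (t t' s : ℤ) :
    seg (seg w u k t') (seg u v k s) k t = seg w v k t := by
  funext i
  rcases lt_trichotomy i k with hik | hik | hki
  · rw [seg_apply_of_lt _ _ hik, seg_apply_of_lt _ _ hik, seg_apply_of_lt _ _ hik]
  · rw [hik, seg_apply_self, seg_apply_self]
  · rw [seg_apply_of_gt _ _ hki, seg_apply_of_gt _ _ hki, seg_apply_of_gt _ _ hki]

/-- (u_{<k}, u_k, u_{>k}) = u. [folklore] -/
theorem seg_self_eq (u v : Fin d → ℤ) (k : Fin d) (h : ∀ i, k < i → v i = u i) : seg u v k (u k) = u := by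
  funext i
  rcases lt_trichotomy i k with hik | hik | hki
  · rw [seg_apply_of_lt _ _ hik]
  · rw [hik, seg_apply_self]
  · rw [seg_apply_of_gt _ _ hki, h i hki]

/-- **The exact load count.**  For k ≠ μ and F ≥ 0 (indeed any F):
Σ_{x,x′∈Δ′} Σ_{s<L−1} F((x′_{<k}, y_k + s, x_{>k})) = #Δ′ · L · Σ_{p∈P_k} F(p) — the triples (x, x′, s) and the triples
(bond start p of direction k, point w ∈ Δ′, value u < L) correspond bijectively (`fwd`/`bwd`). [folklore] -/
theorem load_eq (hL : 1 ≤ L) {y : Fin d → ℤ} {μ k : Fin d} (hk : k ≠ μ) (F : (Fin d → ℤ) → ℝ) :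
    ∑ x ∈ lastLayer L y μ, ∑ x' ∈ lastLayer L y μ, ∑ s ∈ range (L - 1), F (seg x' x k (y k + s)) =
      (#(lastLayer L y μ) : ℝ) * L * ∑ p ∈ starts (lastLayer L y μ) k, F p := by
  set S := lastLayer L y μ with hS
  have lhs : ∑ x ∈ S, ∑ x' ∈ S, ∑ s ∈ range (L - 1), F (seg x' x k (y k + s)) =
      ∑ a ∈ (S ×ˢ S) ×ˢ range (L - 1), F (seg a.1.2 a.1.1 k (y k + a.2)) := by
    rw [sum_product, sum_product]
  have rhs : (#S : ℝ) * L * ∑ p ∈ starts S k, F p = ∑ a ∈ (starts S k ×ˢ S) ×ˢ range L, F a.1.1 := by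
    rw [sum_product, sum_product]
    simp only [sum_const, card_range, nsmul_eq_mul]
    rw [mul_sum]
    refine sum_congr rfl fun p _ => ?_
    ring
  rw [lhs, rhs]
  refine sum_nbij' (fwd y k) (bwd y k) (fun a ha => ?_) (fun a ha => ?_) (fun a ha => ?_) (fun a ha => ?_)
    fun a _ => rfl
  · -- fwd maps into the target
    obtain ⟨⟨x, x'⟩, s⟩ := a
    simp only [mem_product, mem_range] at ha
    obtain ⟨⟨hx, hx'⟩, hs⟩ := ha
    have hxk := mem_block.1 (mem_lastLayer.1 hx).1 k
    have hxk' := mem_block.1 (mem_lastLayer.1 hx').1 k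
    simp only [fwd, mem_product, mem_starts, mem_range]
    refine ⟨⟨⟨seg_mem hk hx' hx (by omega) (by omega), ?_⟩, seg_mem hk hx hx' hxk.1 hxk.2⟩, by omega⟩
    rw [seg_add_unitVec]
    exact seg_mem hk hx' hx (by omega) (by omega)
  · -- bwd maps into the source
    obtain ⟨⟨p, w⟩, u⟩ := a
    simp only [mem_product, mem_range] at ha
    obtain ⟨⟨hp, hw⟩, hu⟩ := ha
    obtain ⟨hp1, hp2⟩ := mem_starts.1 hp
    have hpk := mem_block.1 (mem_lastLayer.1 hp1).1 k
    have hpk2 := mem_block.1 (mem_lastLayer.1 hp2).1 k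
    rw [add_unitVec_apply, if_pos rfl] at hpk2
    have hwk := mem_block.1 (mem_lastLayer.1 hw).1 k
    simp only [bwd, mem_product, mem_range]
    exact ⟨⟨seg_mem hk hw hp1 hwk.1 hwk.2, seg_mem hk hp1 hw (by omega) (by omega)⟩, by omega⟩
  · -- bwd ∘ fwd = id
    obtain ⟨⟨x, x'⟩, s⟩ := a
    simp only [mem_product, mem_range] at ha
    obtain ⟨⟨-, hx'⟩, -⟩ := ha
    have hxk' := mem_block.1 (mem_lastLayer.1 hx').1 k
    have e : y k + (((x' k - y k).toNat : ℕ) : ℤ) = x' k := by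
      rw [Int.toNat_of_nonneg (by omega)]; ring
    simp only [bwd, fwd]
    refine Prod.ext (Prod.ext ?_ ?_) ?_
    · exact seg_seg_eq x x' x' k _
    · dsimp only
      rw [e, seg_seg_eq' x x' x' k]
      exact seg_self_eq x' x' k fun _ _ => rfl
    · dsimp only
      rw [seg_apply_self]; simp
  · -- fwd ∘ bwd = id
    obtain ⟨⟨p, w⟩, u⟩ := a
    simp only [mem_product, mem_range] at ha
    obtain ⟨⟨hp, -⟩, -⟩ := ha
    obtain ⟨hp1, -⟩ := mem_starts.1 hp
    have hpk := mem_block.1 (mem_lastLayer.1 hp1).1 k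
    have e : y k + (((p k - y k).toNat : ℕ) : ℤ) = p k := by
      rw [Int.toNat_of_nonneg (by omega)]; ring
    simp only [bwd, fwd]
    refine Prod.ext (Prod.ext ?_ ?_) ?_
    · dsimp only
      rw [e, seg_seg_eq' w p p k]
      exact seg_self_eq p p k fun _ _ => rfl
    · exact seg_seg_eq w p p k _
    · dsimp only
      rw [seg_apply_self]; simp

/-! ## §4  Pair routing: Σ_{x,x′} (g(x) − g(x′))² ≤ (d − 1)(L − 1) · #Δ′ · L · G(g) -/

/-- The pair-routing estimate. [folklore] -/
theorem pair_sum_le (hL : 1 ≤ L) (y : Fin d → ℤ) (μ : Fin d) (g : (Fin d → ℤ) → ℝ) :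
    ∑ x ∈ lastLayer L y μ, ∑ x' ∈ lastLayer L y μ, (g x - g x') ^ 2 ≤
      ((d : ℝ) - 1) * ((L : ℝ) - 1) * ((#(lastLayer L y μ) : ℝ) * L) * gradSq g (lastLayer L y μ) := by
  set S := lastLayer L y μ with hS
  have hL1 : ((L - 1 : ℕ) : ℝ) = (L : ℝ) - 1 := by rw [Nat.cast_sub hL, Nat.cast_one]
  have hd1 : (0 : ℝ) ≤ (d : ℝ) - 1 := by
    have : 1 ≤ d := Fin.pos μ
    have : (1 : ℝ) ≤ d := by exact_mod_cast this
    linarith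
  have hLm : (0 : ℝ) ≤ (L : ℝ) - 1 := by
    have : (1 : ℝ) ≤ L := by exact_mod_cast hL
    linarith
  -- Step 1: Cauchy–Schwarz over legs, for each pair
  have s1 : ∑ x ∈ S, ∑ x' ∈ S, (g x - g x') ^ 2 ≤
      ∑ x ∈ S, ∑ x' ∈ S, (((d : ℝ) - 1) * ∑ k ∈ univ.erase μ, leg g x x' k ^ 2) :=
    sum_le_sum fun x hx => sum_le_sum fun x' hx' =>
      diff_sq_le_legs g (by rw [(mem_lastLayer.1 hx).2, (mem_lastLayer.1 hx').2])
  -- Step 2: each leg by the window estimate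
  have s2 : ∀ x ∈ S, ∀ x' ∈ S, ∑ k ∈ univ.erase μ, leg g x x' k ^ 2 ≤
      ∑ k ∈ univ.erase μ, (((L : ℝ) - 1) * ∑ s ∈ range (L - 1), bondTerm g k (seg x' x k (y k + s))) :=
    fun x hx x' hx' => sum_le_sum fun k _ => by rw [← hL1]; exact leg_sq_le hx hx' g k
  -- Step 3: exchange sums and count loads
  have e3 : ∑ x ∈ S, ∑ x' ∈ S, (((d : ℝ) - 1) * ∑ k ∈ univ.erase μ, leg g x x' k ^ 2) =
      ((d : ℝ) - 1) * ∑ x ∈ S, ∑ x' ∈ S, ∑ k ∈ univ.erase μ, leg g x x' k ^ 2 := by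
    rw [mul_sum]
    refine sum_congr rfl fun x _ => ?_
    rw [mul_sum]
  have e4 : ∑ x ∈ S, ∑ x' ∈ S, ∑ k ∈ univ.erase μ,
      (((L : ℝ) - 1) * ∑ s ∈ range (L - 1), bondTerm g k (seg x' x k (y k + s))) =
      ((L : ℝ) - 1) *
        ∑ k ∈ univ.erase μ, ∑ x ∈ S, ∑ x' ∈ S, ∑ s ∈ range (L - 1), bondTerm g k (seg x' x k (y k + s)) := by
    calc ∑ x ∈ S, ∑ x' ∈ S, ∑ k ∈ univ.erase μ,
          (((L : ℝ) - 1) * ∑ s ∈ range (L - 1), bondTerm g k (seg x' x k (y k + s)))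
        = ∑ x ∈ S, ∑ k ∈ univ.erase μ, ∑ x' ∈ S,
          (((L : ℝ) - 1) * ∑ s ∈ range (L - 1), bondTerm g k (seg x' x k (y k + s))) :=
            sum_congr rfl fun x _ => sum_comm
      _ = ∑ k ∈ univ.erase μ, ∑ x ∈ S, ∑ x' ∈ S,
          (((L : ℝ) - 1) * ∑ s ∈ range (L - 1), bondTerm g k (seg x' x k (y k + s))) := sum_comm
      _ = _ := by
        rw [mul_sum]
        refine sum_congr rfl fun k _ => ?_
        rw [mul_sum]
        refine sum_congr rfl fun x _ => ?_
        rw [mul_sum]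
  have s3 : ∑ x ∈ S, ∑ x' ∈ S, (((d : ℝ) - 1) * ∑ k ∈ univ.erase μ, leg g x x' k ^ 2) ≤
      ((d : ℝ) - 1) * ((L : ℝ) - 1) *
        ∑ k ∈ univ.erase μ, ∑ x ∈ S, ∑ x' ∈ S, ∑ s ∈ range (L - 1), bondTerm g k (seg x' x k (y k + s)) := by
    rw [e3, mul_assoc, ← e4]
    refine mul_le_mul_of_nonneg_left ?_ hd1
    exact sum_le_sum fun x hx => sum_le_sum fun x' hx' => s2 x hx x' hx'
  have s4 : ∑ k ∈ univ.erase μ, ∑ x ∈ S, ∑ x' ∈ S, ∑ s ∈ range (L - 1), bondTerm g k (seg x' x k (y k + s)) =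
      ((#S : ℝ) * L) * ∑ k ∈ univ.erase μ, ∑ p ∈ starts S k, bondTerm g k p := by
    rw [mul_sum]
    refine sum_congr rfl fun k hk => ?_
    rw [load_eq hL (ne_of_mem_erase hk) (bondTerm g k)]
  have s5 : ∑ k ∈ univ.erase μ, ∑ p ∈ starts S k, bondTerm g k p ≤ gradSq g S := by
    rw [gradSq_eq]
    exact sum_le_sum_of_subset_of_nonneg (erase_subset _ _) fun k _ _ =>
      sum_nonneg fun p _ => bondTerm_nonneg g k p
  have hNL : (0 : ℝ) ≤ (#S : ℝ) * L := by positivity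
  calc ∑ x ∈ S, ∑ x' ∈ S, (g x - g x') ^ 2
      ≤ ∑ x ∈ S, ∑ x' ∈ S, (((d : ℝ) - 1) * ∑ k ∈ univ.erase μ, leg g x x' k ^ 2) := s1
    _ ≤ ((d : ℝ) - 1) * ((L : ℝ) - 1) *
        ∑ k ∈ univ.erase μ, ∑ x ∈ S, ∑ x' ∈ S, ∑ s ∈ range (L - 1), bondTerm g k (seg x' x k (y k + s)) := s3
    _ = ((d : ℝ) - 1) * ((L : ℝ) - 1) * (((#S : ℝ) * L) * ∑ k ∈ univ.erase μ, ∑ p ∈ starts S k, bondTerm g k p) := by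
        rw [s4]
    _ ≤ ((d : ℝ) - 1) * ((L : ℝ) - 1) * (((#S : ℝ) * L) * gradSq g S) :=
        mul_le_mul_of_nonneg_left (mul_le_mul_of_nonneg_left s5 hNL) (mul_nonneg hd1 hLm)
    _ = _ := by ring

/-- The Lagrange identity: Σ_{x,x′∈S} (g(x) − g(x′))² = 2 (#S Σ g² − (Σ g)²). [folklore] -/
theorem lagrange {α : Type*} (S : Finset α) (g : α → ℝ) :
    ∑ x ∈ S, ∑ x' ∈ S, (g x - g x') ^ 2 = 2 * ((#S : ℝ) * ∑ x ∈ S, g x ^ 2 - (∑ x ∈ S, g x) ^ 2) := by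
  have h1 : ∀ x, ∑ x' ∈ S, (g x - g x') ^ 2 =
      (#S : ℝ) * g x ^ 2 - 2 * g x * ∑ x' ∈ S, g x' + ∑ x' ∈ S, g x' ^ 2 := by
    intro x
    simp only [sub_sq, sum_add_distrib, sum_sub_distrib, sum_const, nsmul_eq_mul, ← mul_sum]
  rw [sum_congr rfl fun x _ => h1 x, sum_add_distrib, sum_sub_distrib, sum_const, nsmul_eq_mul]
  have e2 : ∑ x ∈ S, 2 * g x * ∑ x' ∈ S, g x' = 2 * (∑ x ∈ S, g x) * ∑ x' ∈ S, g x' := by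
    rw [← sum_mul, ← mul_sum]
  have e3 : ∑ x ∈ S, (#S : ℝ) * g x ^ 2 = (#S : ℝ) * ∑ x ∈ S, g x ^ 2 := by rw [mul_sum]
  rw [e2, e3]
  ring

/-! ## §5  The constant κ₁ and the layer Poincaré inequality -/

/-- κ₁(d, L) = 2 / (2 + (d − 1)(L − 1)): order 1/L, replacing κ₀ = 1/(4 + 6d(L−1)L^{d−2}) of `B6LayerPoincare`.
[folklore] -/
def kappa1 (d L : ℕ) : ℝ := 2 / (2 + ((d : ℝ) - 1) * ((L : ℝ) - 1))

/-- (d − 1)(L − 1) ≥ 0 for d, L ≥ 1. [folklore] -/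
theorem prod_nonneg' (hd : 1 ≤ d) (hL : 1 ≤ L) : (0 : ℝ) ≤ ((d : ℝ) - 1) * ((L : ℝ) - 1) := by
  have h1 : (1 : ℝ) ≤ d := by exact_mod_cast hd
  have h2 : (1 : ℝ) ≤ L := by exact_mod_cast hL
  exact mul_nonneg (by linarith) (by linarith)

/-- κ₁ > 0. [folklore] -/
theorem kappa1_pos (hd : 1 ≤ d) (hL : 1 ≤ L) : 0 < kappa1 d L :=
  div_pos two_pos (by linarith [prod_nonneg' hd hL])

/-- κ₁ ≤ 1. [folklore] -/
theorem kappa1_le_one (hd : 1 ≤ d) (hL : 1 ≤ L) : kappa1 d L ≤ 1 := by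
  rw [kappa1, div_le_one (by linarith [prod_nonneg' hd hL])]
  linarith [prod_nonneg' hd hL]

/-- κ₁ · (d − 1)(L − 1)/2 ≤ 1. [folklore] -/
theorem kappa1_mul_le (hd : 1 ≤ d) (hL : 1 ≤ L) : kappa1 d L * (((d : ℝ) - 1) * ((L : ℝ) - 1) / 2) ≤ 1 := by
  have hP := prod_nonneg' hd hL
  rw [kappa1, div_mul_div_comm, div_le_one (by linarith)]
  linarith

/-- The pair-routing bound in mean form: #Δ′ Σ g² ≤ (Σ g)² + ½(d − 1)(L − 1) L^d G(g) (#Δ′ = L^{d−1}). [folklore] -/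
theorem card_mul_sum_sq_le (hL : 1 ≤ L) (y : Fin d → ℤ) (μ : Fin d) (g : (Fin d → ℤ) → ℝ) :
    (L : ℝ) ^ (d - 1) * ∑ x ∈ lastLayer L y μ, g x ^ 2 ≤
      (∑ x ∈ lastLayer L y μ, g x) ^ 2 +
        ((d : ℝ) - 1) * ((L : ℝ) - 1) / 2 * ((L : ℝ) ^ d * gradSq g (lastLayer L y μ)) := by
  have h1 := pair_sum_le hL y μ g
  rw [lagrange] at h1
  have hN : (#(lastLayer L y μ) : ℝ) = (L : ℝ) ^ (d - 1) := by
    rw [card_lastLayer hL]; push_cast; ring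
  rw [hN] at h1
  have hd1 : 1 ≤ d := Fin.pos μ
  have hLd : (L : ℝ) ^ (d - 1) * L = (L : ℝ) ^ d := by
    rw [← pow_succ]; congr 1; omega
  rw [hLd] at h1
  linarith

/-- **The layer Poincaré inequality with κ₁, cleared form**: κ₁ L^{d−1} Σ_{x∈Δ′} g(x)² ≤ L^d G(g) + (Σ_{x∈Δ′} g(x))²
— `B6LayerPoincare.layerPoincare_cleared` with κ₀ ↦ κ₁ (DERIVED; the tag names the false sentence repaired, NOT
used). [cite: Balaban1984PropagatorsII, p.245] -/
theorem layerPoincare1_cleared (hd : 2 ≤ d) (hL : 1 ≤ L) (y : Fin d → ℤ) (μ : Fin d) (g : (Fin d → ℤ) → ℝ) :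
    kappa1 d L * (L : ℝ) ^ (d - 1) * ∑ x ∈ lastLayer L y μ, g x ^ 2 ≤
      (L : ℝ) ^ d * gradSq g (lastLayer L y μ) + (∑ x ∈ lastLayer L y μ, g x) ^ 2 := by
  have hd1 : 1 ≤ d := by omega
  have h := card_mul_sum_sq_le hL y μ g
  set A := (∑ x ∈ lastLayer L y μ, g x) ^ 2 with hA
  set Bq := (L : ℝ) ^ d * gradSq g (lastLayer L y μ) with hBq
  set c := ((d : ℝ) - 1) * ((L : ℝ) - 1) / 2 with hc
  have hA0 : 0 ≤ A := sq_nonneg _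
  have hB0 : 0 ≤ Bq := mul_nonneg (by positivity) (gradSq_nonneg _ _)
  have hk0 : 0 ≤ kappa1 d L := (kappa1_pos hd1 hL).le
  have hk1 := kappa1_le_one hd1 hL
  have hkc := kappa1_mul_le hd1 hL
  calc kappa1 d L * (L : ℝ) ^ (d - 1) * ∑ x ∈ lastLayer L y μ, g x ^ 2
      = kappa1 d L * ((L : ℝ) ^ (d - 1) * ∑ x ∈ lastLayer L y μ, g x ^ 2) := by ring
    _ ≤ kappa1 d L * (A + c * Bq) := mul_le_mul_of_nonneg_left h hk0
    _ = kappa1 d L * A + kappa1 d L * c * Bq := by ring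
    _ ≤ 1 * A + 1 * Bq := add_le_add (mul_le_mul_of_nonneg_right hk1 hA0) (mul_le_mul_of_nonneg_right hkc hB0)
    _ = Bq + A := by ring

/-- **The layer Poincaré inequality with κ₁** (same shape as `B6LayerPoincare.layerPoincare`): for d ≥ 2, L ≥ 1,
every corner y, direction μ and g : Z^d → ℝ,
κ₁(d,L) L^{−d−1} Σ_{x∈Δ′} g(x)² ≤ L^{−d} Σ_{b⊂Δ′}(g(b₊) − g(b₋))² + L^{−2}(L^{−(d−1)} Σ_{x∈Δ′} g(x))²,
κ₁ = 2/(2 + (d−1)(L−1)) (DERIVED; the tag names the false sentence repaired, NOT used).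
[cite: Balaban1984PropagatorsII, p.245] -/
theorem layerPoincare1 (hd : 2 ≤ d) (hL : 1 ≤ L) (y : Fin d → ℤ) (μ : Fin d) (g : (Fin d → ℤ) → ℝ) :
    kappa1 d L * ((L : ℝ)⁻¹) ^ (d + 1) * ∑ x ∈ lastLayer L y μ, g x ^ 2 ≤
      ((L : ℝ)⁻¹) ^ d * gradSq g (lastLayer L y μ) +
        ((L : ℝ)⁻¹) ^ 2 * (((L : ℝ)⁻¹) ^ (d - 1) * ∑ x ∈ lastLayer L y μ, g x) ^ 2 := by
  have key := layerPoincare1_cleared hd hL y μ g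
  have hL0 : (0 : ℝ) < L := by exact_mod_cast (Nat.lt_of_lt_of_le Nat.zero_lt_one hL)
  have hL2d : (0 : ℝ) < (L : ℝ) ^ (2 * d) := pow_pos hL0 _
  obtain ⟨k, rfl⟩ : ∃ k, d = k + 2 := ⟨d - 2, by omega⟩
  have e1 : k + 2 - 1 = k + 1 := by omega
  rw [e1] at key ⊢
  have hne : (L : ℝ) ≠ 0 := hL0.ne'
  have lhs : kappa1 (k + 2) L * ((L : ℝ)⁻¹) ^ (k + 2 + 1) * ∑ x ∈ lastLayer L y μ, g x ^ 2 =
      (kappa1 (k + 2) L * (L : ℝ) ^ (k + 1) * ∑ x ∈ lastLayer L y μ, g x ^ 2) / (L : ℝ) ^ (2 * (k + 2)) := by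
    rw [eq_div_iff hL2d.ne']
    simp only [inv_pow]
    field_simp
    ring
  have rhs : ((L : ℝ)⁻¹) ^ (k + 2) * gradSq g (lastLayer L y μ) +
      ((L : ℝ)⁻¹) ^ 2 * (((L : ℝ)⁻¹) ^ (k + 1) * ∑ x ∈ lastLayer L y μ, g x) ^ 2 =
      ((L : ℝ) ^ (k + 2) * gradSq g (lastLayer L y μ) + (∑ x ∈ lastLayer L y μ, g x) ^ 2) /
        (L : ℝ) ^ (2 * (k + 2)) := by
    rw [eq_div_iff hL2d.ne']
    simp only [inv_pow]
    field_simp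
    ring
  rw [lhs, rhs]
  exact div_le_div_of_nonneg_right key hL2d.le

end

end Literature.MathematicalPhysics.QuantumFieldTheory.Balaban1983to89.B6LayerPoincarePair
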